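import Mathlib
import Summits.Ventures.PercRepro2.K5StarGenTablesM

/-!
# THE GENERAL-STAR CERTIFICATES, VI: A STATEMENT IN PARTS
(blind cell PercRepro2, mine-2 g41, 2026-08-29; `proofs/MINE2-GENSTAR.md` §4)

The check node's memory allows one certificate of ≈ 54 alive placements; the 56 statements with 81 or 162
alive placements are certified in PARTS — a partition of the alive placements into pieces each of whose
placement sums is itself nonnegative digitwise (found by a greedy search over the `S₃`-orbits of the
placements, `genstar.c --orbits`; the digitwise inequality is additive): `cSumL_append`,
`cSumL_neg_le_pos_of_parts`, `msum_nonneg_of_digits`, **`starNonnegGen_of_partsM4 / M3 / M0`**.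

Own code; standard axioms.
-/

namespace Summit.Ventures.PercRepro2

open Hub

namespace K5

section Parts

/-- The concatenation of a list of mask lists. -/
def concatL : List (List Mask3) → List Mask3
  | [] => []
  | p :: ps => p ++ concatL ps

/-- `cSumL` over an append. -/
lemma cSumL_append (c : (Fin 10 → Bool) → (Fin 10 → Bool) → (Fin 10 → Bool) → (Fin 10 → Fin 4) → ℕ) :
    ∀ (l₁ l₂ : List Mask3) (k : Fin 10 → Fin 4), cSumL c (l₁ ++ l₂) k = cSumL c l₁ k + cSumL c l₂ k
  | [], l₂, k => by simp [cSumL]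
  | t :: l₁, l₂, k => by
    rw [List.cons_append, cSumL, cSumL, cSumL_append c l₁ l₂ k, add_assoc]

/-- **The digit inequality is additive over the parts**: the certificates of the parts (each of at most
`454` placements) give the inequality at every profile for their concatenation. -/
theorem cSumL_neg_le_pos_of_parts (b : ℕ) : ∀ parts : List (List Mask3),
    (∀ p ∈ parts, p.length ≤ 454 ∧ CertLE8 (sumL (negOn38sw b) p) (sumL (posOn38sw b) p)) →
    ∀ k, cSumL (cNegOn3b b) (concatL parts) k ≤ cSumL (cPosOn3b b) (concatL parts) k
  | [], _, k => by simp [concatL, cSumL]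
  | p :: ps, h, k => by
    rw [concatL, cSumL_append, cSumL_append]
    have hp := h p List.mem_cons_self
    have h1 := cSumL_neg_le_pos_sw b p hp.1 hp.2 k
    have h2 := cSumL_neg_le_pos_of_parts b ps (fun q hq => h q (List.mem_cons_of_mem _ hq)) k
    omega

variable {R : Type*} [Field R] [LinearOrder R] [IsStrictOrderedRing R]

/-- The masked-count sum is nonnegative once the digit inequality holds at every profile. -/
theorem msum_nonneg_of_digits (n : ℕ) (b : Fin 5) (hb : (b : ℕ) = n) (ms : List Mask3)
    (hk : ∀ k, cSumL (cNegOn3b n) ms k ≤ cSumL (cPosOn3b n) ms k) (F : Finset (Fin 10)) (τ : Fin 10 → ℕ) :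
    0 ≤ msum F (fun _ => false) τ (CovForm.K3 (R := R) ends5 0 1 2 3 b) ms := by
  subst hb
  by_cases hτ : ∀ e ∈ F, τ e ≤ 3
  · obtain ⟨k, hk'⟩ := exists_profile F (fun _ => false) τ hτ
    rw [msum_eq b F _ τ k hk' ms]
    have h' : ((cSumL (cNegOn3b b) ms k : ℕ) : R) ≤ ((cSumL (cPosOn3b b) ms k : ℕ) : R) := by
      exact_mod_cast hk k
    linarith
  · have : ∀ ms' : List Mask3, msum F (fun _ => false) τ (CovForm.K3 (R := R) ends5 0 1 2 3 b) ms' = 0 := by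
      intro ms'
      induction ms' with
      | nil => simp [msum]
      | cons t ms' ih => rw [msum, ih, mcount_eq_zero_of_gt3 F _ τ hτ, add_zero]
    rw [this]

/-- **`StarNonnegGen` from the certificates of the parts** (in the swapped index). -/
theorem starNonnegGen_of_parts (n : ℕ) (b : Fin 5) (hb : (b : ℕ) = n) (L : List (Fin 5 × ℕ))
    (parts : List (List Mask3)) (hms : ((placeList L ∅ ∅ ∅).map cmask3).filter alive = concatL parts)
    (hc : ∀ p ∈ parts, p.length ≤ 454 ∧ CertLE8 (sumL (negOn38sw n) p) (sumL (posOn38sw n) p)) :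
    StarNonnegGen R 0 1 2 3 b L := by
  intro F τ _
  rw [placeSum_eq_msum, msum_eq_msum_alive, hms]
  exact msum_nonneg_of_digits n b hb _ (cSumL_neg_le_pos_of_parts n parts hc) F τ

/-- A part's certificate on the nested lazy products at `b = 4` gives its swapped certificate. -/
lemma part_cert4 (p : List Mask3) (q : List (ℕ × ℕ × ℕ)) (hq : p.map swIdx = q)
    (hc : CertLE8 (sumLI negOn38M4 q) (sumLI posOn38M4 q)) :
    CertLE8 (sumL (negOn38sw 4) p) (sumL (posOn38sw 4) p) := by
  obtain ⟨h1, h2⟩ := sumLI_map 4 p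
  rw [← h1, ← h2, hq]
  rwa [sumLI_congr _ _ (negOn38M4_eq), sumLI_congr _ _ (posOn38M4_eq), sumLI_congr _ _ (negOn38L4_eq),
    sumLI_congr _ _ (posOn38L4_eq)] at hc

/-- A part's certificate on the nested lazy products at `b = 3` gives its swapped certificate. -/
lemma part_cert3 (p : List Mask3) (q : List (ℕ × ℕ × ℕ)) (hq : p.map swIdx = q)
    (hc : CertLE8 (sumLI negOn38M3 q) (sumLI posOn38M3 q)) :
    CertLE8 (sumL (negOn38sw 3) p) (sumL (posOn38sw 3) p) := by
  obtain ⟨h1, h2⟩ := sumLI_map 3 p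
  rw [← h1, ← h2, hq]
  rwa [sumLI_congr _ _ (negOn38M3_eq), sumLI_congr _ _ (posOn38M3_eq), sumLI_congr _ _ (negOn38L3_eq),
    sumLI_congr _ _ (posOn38L3_eq)] at hc

/-- A part's certificate on the nested lazy products at `b = 0` gives its swapped certificate. -/
lemma part_cert0 (p : List Mask3) (q : List (ℕ × ℕ × ℕ)) (hq : p.map swIdx = q)
    (hc : CertLE8 (sumLI negOn38M0 q) (sumLI posOn38M0 q)) :
    CertLE8 (sumL (negOn38sw 0) p) (sumL (posOn38sw 0) p) := by
  obtain ⟨h1, h2⟩ := sumLI_map 0 p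
  rw [← h1, ← h2, hq]
  rwa [sumLI_congr _ _ (negOn38M0_eq), sumLI_congr _ _ (posOn38M0_eq), sumLI_congr _ _ (negOn38L0_eq),
    sumLI_congr _ _ (posOn38L0_eq)] at hc

end Parts

end K5

end Summit.Ventures.PercRepro2
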